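import Literature.AlgebraicGeometry.Limits.IdealSheafExtension
import Literature.AlgebraicGeometry.Resolution.BlowupsComposition
import HarnessLib

/-!
# Composition of blowing ups in centres of finite type (Stacks 080B for quasi-compact and
# quasi-separated schemes) and composition of admissible blowing ups (Stacks 080L)

Topic: `Literature/AlgebraicGeometry/Resolution`. Sibling of `BlowupsComposition.lean`, which
proves "composition of blowing ups is a blowing up" (Raynaud; Temkin 2008, Lemma 2.1.4; Stacks,
Tag 080B) over a NOETHERIAN base, where every ideal sheaf is of finite type, and records in its
faithfulness notes that "the qcqs refinement (choosing a finite type `𝓠`) is not formalized".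
This file proves that refinement, i.e. Stacks 080B as printed — for a quasi-compact and
quasi-separated scheme and centres of finite type (= closed subschemes of finite presentation),
the composite of the two blowing ups is the blowing up in a centre OF FINITE TYPE — and deduces
Stacks 080L: the composition of a `U`-admissible blowing up with a `p⁻¹U`-admissible blowing up
is a `U`-admissible blowing up (the form in which admissible blowing ups are used in
Raynaud–Gruson flattening, Stacks 081R, `StrictTransformFlattening.lean`).

* `IsEffectiveCartier.fg_ideal` — an effective Cartier divisor's ideal sheaf is of finite type;
* `IsBlowup.exists_comap_eq_mul_pow_of_fg` — the relative ampleness formula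
  `p⁻¹𝓠 𝒪_{Y'} = 𝓚 · 𝓘_E^d` of the proof of 080B for a blowing up `p` of a QUASI-COMPACT scheme
  in a centre of finite type and an ideal sheaf `𝓚` of finite type upstairs (the Noetherian
  proof of `IsBlowup.exists_comap_eq_mul_pow` verbatim, the Noetherian hypothesis having served
  only to make `𝓟` and `𝓚` of finite type); here `𝓠 = p_*(𝓚 𝓘_E^d) ∩ 𝒪_Y` need not be of
  finite type;
* `IsBlowup.exists_fg_comap_eq_mul_pow` — **the finite type refinement** over a quasi-compact
  quasi-separated base: some `𝓠` OF FINITE TYPE satisfies `p⁻¹𝓠 𝒪_{Y'} = 𝓚 · 𝓘_E^d`. Proof: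
  `𝓠 = ⋃ 𝓠_λ` is the directed union of its sub-ideal-sheaves of finite type (Stacks 01PG,
  `Literature.AlgebraicGeometry.Limits.eq_sSup_fgBelow`); pull-back of ideal sheaves is a left
  adjoint (Mathlib's `Scheme.IdealSheafData.map_gc`), so `𝓚 𝓘_E^d = ⋃ p⁻¹𝓠_λ 𝒪_{Y'}`, and the
  left-hand side, of finite type on the quasi-compact `Y'`, is reached at a finite stage
  (`Literature.AlgebraicGeometry.Limits.exists_le_of_fg_of_le_sSup`). (Stacks reaches the same
  refinement inside the proof of 080B through Properties, Lemma 28.22.3 = Tag 01PG.)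
* `IsBlowup.exists_isBlowup_comp_of_fg` — **Stacks 080B**: for `Y` quasi-compact and
  quasi-separated, `p : Y' → Y` the blowing up in `𝓟` of finite type and `p' : Y'' → Y'` the
  blowing up in `𝓟'` of finite type, `p' ≫ p` is the blowing up of `Y` in an ideal sheaf `𝓠` of
  finite type with `Supp 𝓠 ⊆ Supp 𝓟 ∪ p(Supp 𝓟')`;
* `IsBlowup.exists_isBlowup_comp_admissible` — **Stacks 080L**: `U`-admissible blowing ups
  compose (`U ⊆ Y` open; centre of finite type with support disjoint from `U`, resp. from
  `p⁻¹U`);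
* `IsBlowup.exists_isBlowup_comp_supported_of_fg` — Temkin 2008, Lemma 2.1.4, two-step form for
  coherent (= quasi-compact quasi-separated) schemes: `T`-supported blowing ups compose.

## References

* The Stacks Project, Tag 080B (`divisors-lemma-composition-finite-type-blowups`), Tag 080L
  (`divisors-lemma-composition-admissible-blowups`), Tag 080K (admissible blowing ups), Tag 01PG.
  [StacksProject]
* M. Temkin, *Desingularization of quasi-excellent schemes in characteristic zero*, Adv. Math.
  219 (2008), §2.1, Lemma 2.1.4. [Temkin2008]
* M. Raynaud, L. Gruson, *Critères de platitude et de projectivité*, Invent. Math. 13 (1971),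
  Première partie, Lemme 5.1.4. [RaynaudGruson1971]
-/

noncomputable section

open CategoryTheory CategoryTheory.Limits AlgebraicGeometry TopologicalSpace Opposite

namespace Literature.AlgebraicGeometry.Resolution

universe u

open Literature.AlgebraicGeometry.Limits

/-! ## Effective Cartier divisors are of finite type -/

/-- The ideal sheaf of an effective Cartier divisor is of finite type (locally generated by one
element; finite generation of section ideals is local). [folklore] -/
theorem IsEffectiveCartier.fg_ideal {X : Scheme.{u}} {I : X.IdealSheafData}
    (hI : IsEffectiveCartier I) (W : X.affineOpens) : (I.ideal W).FG := by
  choose U hxU f hf hIU using hI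
  refine fg_ideal_of_le_iSup I (fun x : X => (U x : X.Opens)) (fun x W' hW' => ?_) W
    (fun y _ => Opens.mem_iSup.mpr ⟨y, hxU y⟩)
  have hfg : (Ideal.span {f x}).FG := ⟨{f x}, by simp⟩
  rw [← I.map_ideal (U := W') (V := U x) hW', hIU x]
  exact hfg.map _

/-! ## Relative ampleness of the exceptional divisor over a quasi-compact base -/

/-- **Relative ampleness of the exceptional divisor of a blowing up of a quasi-compact scheme in a
centre of finite type** (the displayed formula `b⁻¹𝓙 𝒪_{X'} = 𝓘_E^d 𝓘_{Z'}` of the proof of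
Stacks, Tag 080B): if `p : Y' → Y` is a blowing up of the quasi-compact scheme `Y` along `𝓟` of
finite type, with exceptional ideal `𝓘_E = p⁻¹𝓟 𝒪_{Y'}`, then for every ideal sheaf `𝓚` of
finite type on `Y'` there are `d` and an ideal sheaf `𝓠` on `Y` with `p⁻¹𝓠 𝒪_{Y'} = 𝓚 · 𝓘_E^d`
(namely `𝓠 = p_*(𝓚 𝓘_E^d) ∩ 𝒪_Y`, not necessarily of finite type). Same proof as the Noetherian
`IsBlowup.exists_comap_eq_mul_pow` (`BlowupsComposition.lean`): over the members of a finite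
affine open cover by `IsBlowup.exists_comap_eq_mul_pow_of_isAffine`, a common exponent, and the
largest candidate `𝓠` dominating the local solutions. [cite: StacksProject, Tag 080B (proof)] -/
theorem IsBlowup.exists_comap_eq_mul_pow_of_fg {Y' Y : Scheme.{u}} [CompactSpace Y] {p : Y' ⟶ Y}
    {P : Y.IdealSheafData} (hp : IsBlowup p P) (hP : ∀ U : Y.affineOpens, (P.ideal U).FG)
    (K : Y'.IdealSheafData) (hK : ∀ U : Y'.affineOpens, (K.ideal U).FG) :
    ∃ (d : ℕ) (Q : Y.IdealSheafData), Q.comap p = K * P.comap p ^ d := by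
  haveI : IsProper p := IsBlowup.isProper_of_fg hP hp
  -- a finite affine open cover of `Y`
  let 𝒰 := Y.affineCover.finiteSubcover
  let U : 𝒰.I₀ → Y.Opens := fun i => (𝒰.f i).opensRange
  have hU : ⨆ i, U i = ⊤ := 𝒰.iSup_opensRange
  haveI : ∀ i, IsAffine (U i : Scheme.{u}) := fun i => isAffineOpen_opensRange (𝒰.f i)
  -- local solutions
  have hloc : ∀ i, ∃ (d : ℕ) (Q : (U i : Scheme.{u}).IdealSheafData),
      Q.comap (p ∣_ U i) = K.comap (p ⁻¹ᵁ U i).ι * (P.comap (U i).ι).comap (p ∣_ U i) ^ d :=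
    fun i => (hp.restrict (U i)).exists_comap_eq_mul_pow_of_isAffine
      (fg_ideal_comap_ι fun W _ => hP W) _ (fg_ideal_comap_ι fun W _ => hK W)
  choose d Q hQ using hloc
  -- a common exponent
  let d₀ : ℕ := ∑ i, d i
  have hd₀ : ∀ i, d i ≤ d₀ := fun i => Finset.single_le_sum (fun j _ => Nat.zero_le (d j))
    (Finset.mem_univ i)
  have hQ' : ∀ i, (Q i * P.comap (U i).ι ^ (d₀ - d i)).comap (p ∣_ U i) =
      (K * P.comap p ^ d₀).comap (p ⁻¹ᵁ U i).ι := fun i => by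
    rw [comap_mul, comap_pow, hQ i, comap_mul, comap_pow, mul_assoc, ← pow_add,
      Nat.add_sub_cancel' (hd₀ i), ← Scheme.IdealSheafData.comap_comp,
      ← Scheme.IdealSheafData.comap_comp, morphismRestrict_ι]
  -- the global candidate dominates the local solutions
  refine ⟨d₀, (K * P.comap p ^ d₀).map p, le_antisymm (Scheme.IdealSheafData.comap_map_le _ _) ?_⟩
  refine le_of_forall_comap_ι_le (fun i => p ⁻¹ᵁ U i) (p.iSup_preimage_eq_top hU) fun i => ?_
  rw [← Scheme.IdealSheafData.comap_comp, ← morphismRestrict_ι, Scheme.IdealSheafData.comap_comp,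
    ← map_morphismRestrict_eq_comap, ← hQ']
  exact Scheme.IdealSheafData.comap_mono _ (Scheme.IdealSheafData.le_map_iff_comap_le.mpr le_rfl)

/-- **The finite type refinement of the relative ampleness formula** (Stacks, Tag 080B, proof:
"we can find a `d ≥ 0` and a finite type ideal sheaf `𝓙 ⊂ 𝒪_X` such that
`𝓘_{Z'} · 𝓘_E^d = b⁻¹𝓙 · 𝒪_{X'}`", there from Properties, Lemma 28.22.3 = Tag 01PG): for a blowing
up `p : Y' → Y` of a quasi-compact and quasi-separated scheme `Y` along `𝓟` of finite type and an
ideal sheaf `𝓚` of finite type on `Y'`, some ideal sheaf `𝓠` OF FINITE TYPE on `Y` satisfies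
`p⁻¹𝓠 𝒪_{Y'} = 𝓚 · 𝓘_E^d`. Proof: the `𝓠` of `exists_comap_eq_mul_pow_of_fg` is the directed
union of its sub-ideal-sheaves `𝓠_λ` of finite type (Tag 01PG, `eq_sSup_fgBelow`), pull-back of
ideal sheaves preserves unions (it is a left adjoint, `Scheme.IdealSheafData.map_gc`), and the
ideal sheaf `𝓚 · 𝓘_E^d` of finite type on the quasi-compact `Y'` equals `p⁻¹𝓠_λ 𝒪_{Y'}` for one
`λ` (`exists_le_of_fg_of_le_sSup`). [cite: StacksProject, Tag 080B (proof)] -/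
theorem IsBlowup.exists_fg_comap_eq_mul_pow {Y' Y : Scheme.{u}} [CompactSpace Y]
    [QuasiSeparatedSpace Y] {p : Y' ⟶ Y} {P : Y.IdealSheafData} (hp : IsBlowup p P)
    (hP : ∀ U : Y.affineOpens, (P.ideal U).FG) (K : Y'.IdealSheafData)
    (hK : ∀ U : Y'.affineOpens, (K.ideal U).FG) :
    ∃ (d : ℕ) (Q : Y.IdealSheafData), (∀ U : Y.affineOpens, (Q.ideal U).FG) ∧
      Q.comap p = K * P.comap p ^ d := by
  obtain ⟨d, Q₀, hQ₀⟩ := hp.exists_comap_eq_mul_pow_of_fg hP K hK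
  haveI : IsProper p := IsBlowup.isProper_of_fg hP hp
  haveI : CompactSpace Y' := QuasiCompact.compactSpace_of_compactSpace p
  -- `K · 𝓘_E^d` is of finite type
  have hE : ∀ U : Y'.affineOpens, ((P.comap p).ideal U).FG := hp.isEffectiveCartier.fg_ideal
  have hKE : ∀ U : Y'.affineOpens, ((K * P.comap p ^ d).ideal U).FG := fun U => by
    rw [Scheme.IdealSheafData.ideal_mul, Scheme.IdealSheafData.ideal_pow, Pi.mul_apply,
      Pi.pow_apply]
    exact (hK U).mul (hE U).pow
  -- `K · 𝓘_E^d = p⁻¹Q₀ = ⋃ p⁻¹Q_λ` over the sub-ideal-sheaves `Q_λ ⊆ Q₀` of finite type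
  have hS : K * P.comap p ^ d ≤
      sSup ((fun J : Y.IdealSheafData => J.comap p) '' fgBelow Q₀) := by
    rw [sSup_image, ← (Scheme.IdealSheafData.map_gc p).l_sSup, ← eq_sSup_fgBelow Q₀, hQ₀]
  have hne : ((fun J : Y.IdealSheafData => J.comap p) '' fgBelow Q₀).Nonempty :=
    ⟨_, ⊥, bot_mem_fgBelow Q₀, rfl⟩
  have hdir : DirectedOn (· ≤ ·) ((fun J : Y.IdealSheafData => J.comap p) '' fgBelow Q₀) := by
    rintro _ ⟨J, hJ, rfl⟩ _ ⟨J', hJ', rfl⟩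
    obtain ⟨J'', hJ'', h1, h2⟩ := directedOn_fgBelow Q₀ J hJ J' hJ'
    exact ⟨_, ⟨J'', hJ'', rfl⟩, Scheme.IdealSheafData.comap_mono _ h1,
      Scheme.IdealSheafData.comap_mono _ h2⟩
  obtain ⟨_, ⟨J, hJ, rfl⟩, hKJ⟩ := exists_le_of_fg_of_le_sSup (K * P.comap p ^ d) hKE hne hdir hS
  refine ⟨d, J, hJ.1, le_antisymm ?_ hKJ⟩
  rw [← hQ₀]
  exact Scheme.IdealSheafData.comap_mono _ hJ.2

/-! ## Composition of blowing ups in centres of finite type (Stacks 080B) -/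

/-- **Stacks 080B, with the centre of the composite a multiple of the first centre**: as in
`IsBlowup.exists_isBlowup_comp_of_fg` below, but recording that the composite `Y'' → Y' → Y` is
the blowing up in `𝓟 · 𝓡` for an ideal sheaf `𝓡` of finite type — so that its support CONTAINS
`Supp 𝓟` (needed when the dense open of a strict transform must stay `Y ∖ Supp 𝓟`).
[cite: StacksProject, Tag 080B] -/
theorem IsBlowup.exists_isBlowup_comp_mul_of_fg {Y'' Y' Y : Scheme.{u}} [CompactSpace Y]
    [QuasiSeparatedSpace Y] {p : Y' ⟶ Y} {P : Y.IdealSheafData} {p' : Y'' ⟶ Y'}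
    {P' : Y'.IdealSheafData} (hp : IsBlowup p P) (hP : ∀ U : Y.affineOpens, (P.ideal U).FG)
    (hp' : IsBlowup p' P') (hP' : ∀ U : Y'.affineOpens, (P'.ideal U).FG) :
    ∃ R : Y.IdealSheafData, (∀ U : Y.affineOpens, (R.ideal U).FG) ∧ IsBlowup (p' ≫ p) (P * R) ∧
      ((P * R).support : Set Y) ⊆ P.support ∪ p '' (P'.support : Set Y') := by
  obtain ⟨d, R, hRfg, hR⟩ := hp.exists_fg_comap_eq_mul_pow hP P' hP'
  have hp'' : IsBlowup p' (R.comap p) := by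
    rw [hR]
    exact hp'.mul_of_isEffectiveCartier (hp.isEffectiveCartier.pow d)
  refine ⟨R, hRfg, hp.comp hp'', ?_⟩
  rintro y (hy | hy)
  · exact Or.inl hy
  by_cases hyP : y ∈ (P.support : Set Y)
  · exact Or.inl hyP
  right
  -- over the complement of `Supp P`, `p` is an isomorphism: lift `y` to `y' ∈ Y'`
  let U : Y.Opens := ⟨(P.support : Set Y)ᶜ, P.support.isClosed.isOpen_compl⟩
  haveI : IsIso (p ∣_ U) := hp.isIso_compl
  obtain ⟨z, hz⟩ := (ConcreteCategory.bijective_of_isIso (p ∣_ U).base).2 ⟨y, hyP⟩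
  let y' : Y' := (p ⁻¹ᵁ U).ι z
  have hy' : p y' = y := by
    have := morphismRestrict_base_coe p U z
    rw [hz] at this
    exact this.symm
  refine ⟨y', ?_, hy'⟩
  -- `y'` lies in `Supp (p⁻¹R) = Supp P' ∪ Supp 𝓘_E^d` but not in `Supp 𝓘_E = p⁻¹ Supp P`
  have h1 : y' ∈ ((R.comap p).support : Set Y') := by
    rw [Scheme.IdealSheafData.support_comap]
    change p y' ∈ (R.support : Set Y)
    rw [hy']
    exact hy
  rw [hR, Scheme.IdealSheafData.support_mul] at h1
  rcases h1 with h1 | h1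
  · exact h1
  · exfalso
    apply hyP
    rw [← hy']
    have h2 : y' ∈ ((P.comap p).support : Set Y') := by
      rcases Nat.eq_zero_or_pos d with rfl | hd
      · rw [pow_zero, Scheme.IdealSheafData.one_eq_top, Scheme.IdealSheafData.support_top] at h1
        exact h1.elim
      · rwa [Scheme.IdealSheafData.support_pow _ _ hd.ne'] at h1
    rw [Scheme.IdealSheafData.support_comap] at h2
    exact h2

/-- **Stacks, Tag 080B (composition of blowing ups in centres of finite presentation), for
quasi-compact and quasi-separated schemes.** "Let `X` be a quasi-compact and quasi-separated
scheme. Let `Z ⊂ X` be a closed subscheme of finite presentation. Let `b : X' → X` be the blowing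
up with center `Z`. Let `Z' ⊂ X'` be a closed subscheme of finite presentation. Let `X'' → X'` be
the blowing up with center `Z'`. There exists a closed subscheme `Y ⊂ X` of finite presentation,
such that (1) `Y = Z ∪ b(Z')` set theoretically, and (2) the composition `X'' → X` is isomorphic
to the blowing up of `X` in `Y`." Rendered with blowing ups in the sense of the universal
property (`IsBlowup`) and closed subschemes of finite presentation as ideal sheaves of finite
type (`Z = V(𝓟)`, `Z' = V(𝓟')`, `Y = V(𝓠)`), with the inclusion `Supp 𝓠 ⊆ Supp 𝓟 ∪ p(Supp 𝓟')`
of (1). Proof as printed: `p⁻¹𝓡 𝒪_{Y'} = 𝓟' · 𝓘_E^d` with `𝓡` of finite type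
(`exists_fg_comap_eq_mul_pow`), so `p'` is also the blowing up of `Y'` along `p⁻¹𝓡 𝒪_{Y'}`
(twisting by the effective Cartier divisor `dE`, `IsBlowup.mul_of_isEffectiveCartier`) and
`p' ≫ p` that of `Y` along the finite type ideal `𝓠 = 𝓟 · 𝓡` (Tag 080A, `IsBlowup.comp`); off
`Supp 𝓟` the map `p` is an isomorphism under which `Supp 𝓡` corresponds to `Supp 𝓟'`.
[cite: StacksProject, Tag 080B] -/
theorem IsBlowup.exists_isBlowup_comp_of_fg {Y'' Y' Y : Scheme.{u}} [CompactSpace Y]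
    [QuasiSeparatedSpace Y] {p : Y' ⟶ Y} {P : Y.IdealSheafData} {p' : Y'' ⟶ Y'}
    {P' : Y'.IdealSheafData} (hp : IsBlowup p P) (hP : ∀ U : Y.affineOpens, (P.ideal U).FG)
    (hp' : IsBlowup p' P') (hP' : ∀ U : Y'.affineOpens, (P'.ideal U).FG) :
    ∃ Q : Y.IdealSheafData, (∀ U : Y.affineOpens, (Q.ideal U).FG) ∧ IsBlowup (p' ≫ p) Q ∧
      (Q.support : Set Y) ⊆ P.support ∪ p '' (P'.support : Set Y') := by
  obtain ⟨R, hRfg, hQ, hsupp⟩ := hp.exists_isBlowup_comp_mul_of_fg hP hp' hP'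
  refine ⟨P * R, fun U => ?_, hQ, hsupp⟩
  rw [Scheme.IdealSheafData.ideal_mul, Pi.mul_apply]
  exact (hP U).mul (hRfg U)

/-! ## Composition of admissible blowing ups (Stacks 080L) and of `T`-supported blowing ups -/

/-- **Stacks, Tag 080L (composition of admissible blowing ups).** "Let `X` be a quasi-compact and
quasi-separated scheme. Let `U ⊂ X` be a quasi-compact open subscheme. Let `b : X' → X` be a
`U`-admissible blowing up. Let `X'' → X'` be a `b⁻¹(U)`-admissible blowing up. Then the
composition `X'' → X` is a `U`-admissible blowing up." Here (Tag 080K) a `U`-admissible blowing up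
is the blowing up in a closed subscheme of finite presentation disjoint from `U`, rendered — as
in `Stacks081R` (`StrictTransformFlattening.lean`) — by an ideal sheaf of finite type whose
support is disjoint from `U` and a blowing up along it in the sense of the universal property;
quasi-compactness of `U` is not needed for this statement. From `exists_isBlowup_comp_of_fg` and
`Supp 𝓠 ⊆ Supp 𝓟 ∪ p(Supp 𝓟')`. [cite: StacksProject, Tag 080L] -/
theorem IsBlowup.exists_isBlowup_comp_admissible {Y'' Y' Y : Scheme.{u}} [CompactSpace Y]
    [QuasiSeparatedSpace Y] (U : Y.Opens) {p : Y' ⟶ Y} {P : Y.IdealSheafData} {p' : Y'' ⟶ Y'}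
    {P' : Y'.IdealSheafData} (hp : IsBlowup p P) (hP : ∀ W : Y.affineOpens, (P.ideal W).FG)
    (hPU : Disjoint (U : Set Y) (P.support : Set Y)) (hp' : IsBlowup p' P')
    (hP' : ∀ W : Y'.affineOpens, (P'.ideal W).FG)
    (hP'U : Disjoint ((p ⁻¹ᵁ U : Y'.Opens) : Set Y') (P'.support : Set Y')) :
    ∃ Q : Y.IdealSheafData, (∀ W : Y.affineOpens, (Q.ideal W).FG) ∧
      Disjoint (U : Set Y) (Q.support : Set Y) ∧ IsBlowup (p' ≫ p) Q := by
  obtain ⟨Q, hQfg, hQ, hsupp⟩ := hp.exists_isBlowup_comp_of_fg hP hp' hP'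
  refine ⟨Q, hQfg, Set.disjoint_left.mpr fun y hyU hyQ => ?_, hQ⟩
  rcases hsupp hyQ with hy | ⟨y', hy', rfl⟩
  · exact Set.disjoint_left.mp hPU hyU hy
  · exact Set.disjoint_left.mp hP'U (show y' ∈ ((p ⁻¹ᵁ U : Y'.Opens) : Set Y') from hyU) hy'

/-- **Temkin 2008, Lemma 2.1.4 (Raynaud), two blow-ups of a coherent scheme**: "If `X` is
coherent, `V ↪ X` is open and `T = X ∖ V`, then a composition of `V`-admissible (or
`T`-supported) blow ups is a `V`-admissible (or `T`-supported) blow up" — here for `X = Y`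
quasi-compact and quasi-separated (coherent), a `T`-supported blow-up `p` in a centre of finite
type (`Supp 𝓟 ⊆ T`) followed by a `T`-supported blow-up `p'` of the `Y`-scheme `Y'` in a centre
of finite type (`Supp 𝓟' ⊆ p⁻¹(T)`): the composite is a blow-up of `Y` along an ideal sheaf OF
FINITE TYPE supported in `T` (the qcqs form of `IsBlowup.exists_isBlowup_comp_supported`, which
assumes `Y` Noetherian). [cite: Temkin2008, Lemma 2.1.4] -/
theorem IsBlowup.exists_isBlowup_comp_supported_of_fg {Y'' Y' Y : Scheme.{u}} [CompactSpace Y]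
    [QuasiSeparatedSpace Y] (p : Y' ⟶ Y) (P : Y.IdealSheafData) (p' : Y'' ⟶ Y')
    (P' : Y'.IdealSheafData) (T : Set Y) (hp : IsBlowup p P)
    (hP : ∀ W : Y.affineOpens, (P.ideal W).FG) (hPT : (P.support : Set Y) ⊆ T)
    (hp' : IsBlowup p' P') (hP' : ∀ W : Y'.affineOpens, (P'.ideal W).FG)
    (hP'T : (P'.support : Set Y') ⊆ p ⁻¹' T) :
    ∃ Q : Y.IdealSheafData, (∀ W : Y.affineOpens, (Q.ideal W).FG) ∧ IsBlowup (p' ≫ p) Q ∧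
      (Q.support : Set Y) ⊆ T := by
  obtain ⟨Q, hQfg, hQ, hsupp⟩ := hp.exists_isBlowup_comp_of_fg hP hp' hP'
  exact ⟨Q, hQfg, hQ, hsupp.trans (Set.union_subset hPT (Set.image_subset_iff.mpr hP'T))⟩

end Literature.AlgebraicGeometry.Resolution

end
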